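import Summits.AtomisticToContinuum.Crystallization.Theorems.OverbindingBudgetAffineFarFieldCellTRD

/-!
# OverbindingBudget (2c) — part 27Vb-K(C): the cubic clause of the ideal `h`-cell (lens-4 g95; r1673/r1681 S3 «27Vb-K ideal cells»)

Support file, pure analysis on `ℝ³ = EuclideanSpace ℝ (Fin 3)`, no atlas.  The `h`-cell `trdCell h` of
part 27Vb-K(B2) has no inversion centre, so the cubic Taylor term of a cell average does not vanish by
symmetry; the tree's `cell_taylor_tau` (part 27Va-B) consumes instead a CUBIC CLAUSE
`∀ B, |∫_K B(x-p,x-p,x-p)| ≤ τ·|K|·‖B‖`.  This file proves that clause for `K = trdCell h`, `p = 0`,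
with `τ = (14/45)·h³`, from ONE more shape constant of the unit cell,
`hT : |∫_{trdCell 1} x₀x₁x₂| ≤ 112/405` (exact value `112/405`, by exact rational integration), next to
the radial constants leaf `hC : HasRadialMoments (rdCell 1) 16 24 (656/15)` of part 27Vb-K(A):

* `three_form_expand`, `integral_three_form`, `abs_integral_three_form_le` — a trilinear form on the
  diagonal in coordinates and the `ℓ¹` CUBIC-MOMENT BOUND `|∫_K B(x,x,x)| ≤ (Σ_{ijk}|∫_K x_i x_j x_k|)·‖B‖`
  on any compact cell (`cubicMoment K i j k := ∫_K x_i x_j x_k`);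
* ★ `cubicMoment_trdCell_eq`: the cubic tensor of `trdCell h` is determined by its `D₃ₕ` symmetry
  (part (B1): 3-cycle, coordinate swap, basal reflection) up to ONE scalar,
  `∫ x_i x_j x_k = (∫ x₀x₁x₂)·cubicSign i j k` with `cubicSign = +1` on `iii` and on `ijk` distinct,
  `-1/2` on `iij`: the 3-cycle and the swap leave three classes, and the basal reflection kills
  `∫(Σx)³` and `∫(Σx)‖x‖²`, which pins `iii = ijk`, `iij = -iii/2`; hence
  `Σ_{ijk}|∫ x_i x_j x_k| = 18·|∫ x₀x₁x₂|` (`sum_abs_cubicMoment_trdCell`);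
* invariance of `trdCell h` under the swap and the basal reflection; exact scaling `trdCell h = h • trdCell 1`,
  `cubicMoment (trdCell h) = h⁶ · cubicMoment (trdCell 1)`;
* ★ `cubic_form_trdCell_le`: `|∫_{trdCell h} B(x,x,x)| ≤ (224/45)·h⁶·‖B‖`; ★ `cubic_clause_trdCell`: the
  clause of `cell_taylor_tau` with `τ = (14/45)·h³` (volume `16h³` from `hC`); `cubic_clause_trdCell_nu`
  at `h = ν/(2√2)` and `cubic_tau_nu : (14/45)(ν/(2√2))³ = 7ν³/(360√2)` (`≈ 0.01375·ν³`).

Desk size (DESK27V-g94 §2, cube frame; r1681 (γ) accepted): `E_T ≈ 9.7e-8` per mover, against a column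
of `0.9e-5` and a pass line of `1.5e-5` — the cube-frame `ℓ¹` constant costs a factor `2.4` over an
adapted frame, booked as known slack.
-/

namespace Summit.AtomisticToContinuum.Crystallization.Theorems.OverbindingBudgetAffineFarFieldCellTRDCubic

noncomputable section

open MeasureTheory Set
open scoped Pointwise
open Summit.AtomisticToContinuum.Crystallization.Theorems.OverbindingBudgetAffineFarFieldCellTaylor
open Summit.AtomisticToContinuum.Crystallization.Theorems.OverbindingBudgetAffineFarFieldCellSymm
open Summit.AtomisticToContinuum.Crystallization.Theorems.OverbindingBudgetAffineFarFieldCellRD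
open Summit.AtomisticToContinuum.Crystallization.Theorems.OverbindingBudgetAffineFarFieldCellTwist
open Summit.AtomisticToContinuum.Crystallization.Theorems.OverbindingBudgetAffineFarFieldCellTRD

local notation "E3" => EuclideanSpace ℝ (Fin 3)

/-! ### Trilinear forms on the diagonal, in coordinates -/

/-- Linearity in one slot of a trilinear form, expanded in the basis `e3`. -/
theorem slot_expand₃ (B : E3 [×3]→L[ℝ] ℝ) (m : Fin 3 → E3) (k : Fin 3) (w : E3) :
    B (Function.update m k w) = ∑ j : Fin 3, w j * B (Function.update m k (e3 j)) := by
  have hL : ∀ v : E3, B (Function.update m k v) = B.toContinuousLinearMap m k v := fun v => rfl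
  rw [hL]
  conv_lhs => rw [expand_e3 w]
  rw [map_sum]
  refine Finset.sum_congr rfl (fun j _ => ?_)
  rw [map_smul, smul_eq_mul, hL]

/-- A trilinear form on the diagonal, expanded in coordinates:
`B(w,w,w) = Σ_{ijk} w_i w_j w_k · B(e_i,e_j,e_k)`. -/
theorem three_form_expand (B : E3 [×3]→L[ℝ] ℝ) (w : E3) :
    B (fun _ => w) = ∑ i : Fin 3, ∑ j : Fin 3, ∑ k : Fin 3, (w i * w j * w k) * B ![e3 i, e3 j, e3 k] := by
  have t0 : (fun _ : Fin 3 => w) = Function.update ![w, w, w] 0 w := by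
    funext l; fin_cases l <;> simp
  rw [t0, slot_expand₃]
  refine Finset.sum_congr rfl (fun i _ => ?_)
  have t1 : Function.update ![w, w, w] 0 (e3 i) = Function.update ![e3 i, w, w] 1 w := by
    funext l; fin_cases l <;> simp
  rw [t1, slot_expand₃, Finset.mul_sum]
  refine Finset.sum_congr rfl (fun j _ => ?_)
  have t2 : Function.update ![e3 i, w, w] 1 (e3 j) = Function.update ![e3 i, e3 j, w] 2 w := by
    funext l; fin_cases l <;> simp
  rw [t2, slot_expand₃, Finset.mul_sum, Finset.mul_sum]
  refine Finset.sum_congr rfl (fun k _ => ?_)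
  have t3 : Function.update ![e3 i, e3 j, w] 2 (e3 k) = ![e3 i, e3 j, e3 k] := by
    funext l; fin_cases l <;> simp
  rw [t3]
  ring

/-- `|B(e_i,e_j,e_k)| ≤ ‖B‖`. -/
theorem abs_three_form_e3_le (B : E3 [×3]→L[ℝ] ℝ) (i j k : Fin 3) : |B ![e3 i, e3 j, e3 k]| ≤ ‖B‖ := by
  simpa [Fin.prod_univ_three, norm_e3] using B.le_opNorm ![e3 i, e3 j, e3 k]

/-! ### Cubic moments of a cell -/

/-- support: the CUBIC MOMENT `∫_K x_i x_j x_k` of a cell `K ⊆ ℝ³` (about the origin). -/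
def cubicMoment (K : Set E3) (i j k : Fin 3) : ℝ := ∫ x in K, x i * x j * x k

/-- Cubic moments are symmetric in the first two indices. -/
theorem cubicMoment_swap₁₂ (K : Set E3) (i j k : Fin 3) : cubicMoment K i j k = cubicMoment K j i k := by
  unfold cubicMoment; congr 1; funext x; ring

/-- Cubic moments are symmetric in the last two indices. -/
theorem cubicMoment_swap₂₃ (K : Set E3) (i j k : Fin 3) : cubicMoment K i j k = cubicMoment K i k j := by
  unfold cubicMoment; congr 1; funext x; ring

/-- Integral of a coordinate cubic `Σ c_ijk x_i x_j x_k` over a compact cell, as cubic moments. -/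
theorem integral_cubic_sum {K : Set E3} (hK : IsCompact K) (c : Fin 3 → Fin 3 → Fin 3 → ℝ) :
    ∫ x in K, ∑ i : Fin 3, ∑ j : Fin 3, ∑ k : Fin 3, (x i * x j * x k) * c i j k
      = ∑ i : Fin 3, ∑ j : Fin 3, ∑ k : Fin 3, cubicMoment K i j k * c i j k := by
  have hci : ∀ i : Fin 3, Continuous fun x : E3 => x i := fun i => (EuclideanSpace.proj i).continuous
  have hint : ∀ i j k : Fin 3,
      Integrable (fun x : E3 => (x i * x j * x k) * c i j k) (volume.restrict K) := fun i j k =>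
    ((((hci i).mul (hci j)).mul (hci k)).mul continuous_const).continuousOn.integrableOn_compact hK
  rw [integral_finsetSum _ (fun i _ => integrable_finsetSum _ (fun j _ =>
    integrable_finsetSum _ (fun k _ => hint i j k)))]
  refine Finset.sum_congr rfl (fun i _ => ?_)
  rw [integral_finsetSum _ (fun j _ => integrable_finsetSum _ (fun k _ => hint i j k))]
  refine Finset.sum_congr rfl (fun j _ => ?_)
  rw [integral_finsetSum _ (fun k _ => hint i j k)]
  refine Finset.sum_congr rfl (fun k _ => ?_)
  rw [integral_mul_const, cubicMoment]

/-- Integral of `Σ_{ab} c_ab x_a x_b x_b` over a compact cell, as cubic moments. -/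
theorem integral_cubic_sum₂ {K : Set E3} (hK : IsCompact K) (c : Fin 3 → Fin 3 → ℝ) :
    ∫ x in K, ∑ a : Fin 3, ∑ b : Fin 3, (x a * x b * x b) * c a b
      = ∑ a : Fin 3, ∑ b : Fin 3, cubicMoment K a b b * c a b := by
  have hci : ∀ i : Fin 3, Continuous fun x : E3 => x i := fun i => (EuclideanSpace.proj i).continuous
  have hint : ∀ a b : Fin 3,
      Integrable (fun x : E3 => (x a * x b * x b) * c a b) (volume.restrict K) := fun a b =>
    ((((hci a).mul (hci b)).mul (hci b)).mul continuous_const).continuousOn.integrableOn_compact hK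
  rw [integral_finsetSum _ (fun a _ => integrable_finsetSum _ (fun b _ => hint a b))]
  refine Finset.sum_congr rfl (fun a _ => ?_)
  rw [integral_finsetSum _ (fun b _ => hint a b)]
  refine Finset.sum_congr rfl (fun b _ => ?_)
  rw [integral_mul_const, cubicMoment]

/-- `∫_K B(x,x,x) = Σ_{ijk} (∫_K x_i x_j x_k) · B(e_i,e_j,e_k)` on a compact cell. -/
theorem integral_three_form {K : Set E3} (hK : IsCompact K) (B : E3 [×3]→L[ℝ] ℝ) :
    ∫ x in K, B (fun _ => x)
      = ∑ i : Fin 3, ∑ j : Fin 3, ∑ k : Fin 3, cubicMoment K i j k * B ![e3 i, e3 j, e3 k] := by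
  have e : (fun x : E3 => B (fun _ => x))
      = fun x => ∑ i : Fin 3, ∑ j : Fin 3, ∑ k : Fin 3, (x i * x j * x k) * B ![e3 i, e3 j, e3 k] := by
    funext x; exact three_form_expand B x
  rw [e]
  exact integral_cubic_sum hK (fun i j k => B ![e3 i, e3 j, e3 k])

/-- support: the `ℓ¹` CUBIC-MOMENT BOUND — `|∫_K B(x,x,x)| ≤ (Σ_{ijk} |∫_K x_i x_j x_k|)·‖B‖` for every
continuous trilinear form `B` on a compact cell `K`. -/
theorem abs_integral_three_form_le {K : Set E3} (hK : IsCompact K) (B : E3 [×3]→L[ℝ] ℝ) :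
    |∫ x in K, B (fun _ => x)|
      ≤ (∑ i : Fin 3, ∑ j : Fin 3, ∑ k : Fin 3, |cubicMoment K i j k|) * ‖B‖ := by
  rw [integral_three_form hK B, Finset.sum_mul]
  refine (Finset.abs_sum_le_sum_abs _ _).trans (Finset.sum_le_sum fun i _ => ?_)
  rw [Finset.sum_mul]
  refine (Finset.abs_sum_le_sum_abs _ _).trans (Finset.sum_le_sum fun j _ => ?_)
  rw [Finset.sum_mul]
  refine (Finset.abs_sum_le_sum_abs _ _).trans (Finset.sum_le_sum fun k _ => ?_)
  rw [abs_mul]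
  exact mul_le_mul_of_nonneg_left (abs_three_form_e3_le B i j k) (abs_nonneg _)

/-- Cubic moments are invariant under a linear isometry leaving the cell invariant (about `0`). -/
theorem cubicMoment_comp_inv {K : Set E3} {T : E3 ≃ₗᵢ[ℝ] E3} (hT : IsInvariantUnder K 0 T)
    (hT' : IsInvariantUnder K 0 T.symm) (i j k : Fin 3) :
    ∫ x in K, (T x) i * (T x) j * (T x) k = cubicMoment K i j k := by
  have e := setIntegral_comp_inv hT hT' (fun y : E3 => y i * y j * y k)
  rw [cubicMoment]
  simpa only [sub_zero, zero_add] using e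

/-! ### Invariance of the ideal `h`-cell under the swap and the basal reflection -/

/-- The `h`-cell is invariant under the coordinate swap (a mirror containing the stacking axis). -/
theorem trdCell_invariant_swap (h : ℝ) : IsInvariantUnder (trdCell h) 0 swapIso := by
  intro x hx
  rw [sub_zero, zero_add, mem_trdCell, halfTwist_swapIso]
  simpa using rdCell_invariant_swap h (halfTwist x) hx

/-- The `h`-cell is invariant under the inverse coordinate swap. -/
theorem trdCell_invariant_swap_symm (h : ℝ) : IsInvariantUnder (trdCell h) 0 swapIso.symm := by
  rw [swapIso_symm]; exact trdCell_invariant_swap h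

/-- The ideal `h`-cell is symmetric under the basal reflection. -/
theorem trdCell_invariant_basalRefl (h : ℝ) : IsInvariantUnder (trdCell h) 0 basalRefl := by
  intro x hx
  rw [sub_zero, zero_add]
  have hs := axSumL_basalRefl x
  rcases lt_trichotomy (axSumL x) 0 with hlt | heq | hgt
  · rw [mem_trdCell_of_nonneg (by rw [hs]; linarith), basalRefl_apply, neg_mem_rdCell_iff]
    exact (mem_trdCell_of_neg hlt).1 hx
  · rw [basalRefl_apply, halfTurn_of_axSum_zero heq, neg_neg]
    exact hx
  · rw [mem_trdCell_of_neg (by rw [hs]; linarith), basalRefl_apply, map_neg, halfTurn_halfTurn,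
      neg_mem_rdCell_iff]
    exact (mem_trdCell_of_nonneg hgt.le).1 hx

/-- The `h`-cell is invariant under the inverse basal reflection. -/
theorem trdCell_invariant_basalRefl_symm (h : ℝ) : IsInvariantUnder (trdCell h) 0 basalRefl.symm := by
  rw [basalRefl_symm]; exact trdCell_invariant_basalRefl h

/-! ### The cubic moments of the ideal `h`-cell -/

/-- Odd axial moments vanish: `∫_{trdCell h} (x₀+x₁+x₂)³ = 0` (basal reflection). -/
theorem integral_axSum_cube_trdCell (h : ℝ) : ∫ x in trdCell h, (axSumL x) ^ 3 = 0 := by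
  have e := setIntegral_comp_inv (trdCell_invariant_basalRefl h) (trdCell_invariant_basalRefl_symm h)
    (fun y : E3 => (axSumL y) ^ 3)
  simp only [sub_zero, zero_add, axSumL_basalRefl] at e
  have e' : ∫ x in trdCell h, (-axSumL x) ^ 3 = -∫ x in trdCell h, (axSumL x) ^ 3 := by
    rw [← integral_neg]; congr 1; funext x; ring
  linarith

/-- `∫_{trdCell h} (x₀+x₁+x₂)·‖x‖² = 0` (basal reflection). -/
theorem integral_axSum_normSq_trdCell (h : ℝ) : ∫ x in trdCell h, axSumL x * ‖x‖ ^ 2 = 0 := by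
  have e := setIntegral_comp_inv (trdCell_invariant_basalRefl h) (trdCell_invariant_basalRefl_symm h)
    (fun y : E3 => axSumL y * ‖y‖ ^ 2)
  simp only [sub_zero, zero_add, axSumL_basalRefl, LinearIsometryEquiv.norm_map] at e
  have e' : ∫ x in trdCell h, -axSumL x * ‖x‖ ^ 2 = -∫ x in trdCell h, axSumL x * ‖x‖ ^ 2 := by
    rw [← integral_neg]; congr 1; funext x; ring
  linarith

/-- support: the SIGN PATTERN of the cubic tensor of the `h`-cell in the cube frame:
`+1` on `iii` and on `ijk` distinct, `-1/2` on `iij`. -/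
def cubicSign (i j k : Fin 3) : ℝ :=
  if i = j ∧ j = k then 1 else if i = j ∨ j = k ∨ i = k then -(1 / 2) else 1

/-- `Σ_{ijk} |cubicSign i j k| = 3 + 18·(1/2) + 6 = 18`. -/
theorem sum_abs_cubicSign : ∑ i : Fin 3, ∑ j : Fin 3, ∑ k : Fin 3, |cubicSign i j k| = 18 := by
  simp [Fin.sum_univ_three, cubicSign]
  norm_num

/-- ★ **The cubic tensor of the ideal `h`-cell is determined by its `D₃ₕ` symmetry up to ONE scalar**:
`∫ x_i x_j x_k = (∫ x₀x₁x₂)·cubicSign i j k` over `trdCell h` — the 3-cycle and the swap leave the three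
classes `iii`, `iij`, `ijk`; the basal reflection kills `∫(Σx)³` and `∫(Σx)‖x‖²`, which pins
`iii = ijk = t` and `iij = -t/2`. -/
theorem cubicMoment_trdCell_eq {h : ℝ} (hh : 0 ≤ h) (i j k : Fin 3) :
    cubicMoment (trdCell h) i j k = cubicMoment (trdCell h) 0 1 2 * cubicSign i j k := by
  have hK := isCompact_trdCell hh
  -- symmetry of the tensor in its indices
  have S12 := cubicMoment_swap₁₂ (trdCell h)
  have S23 := cubicMoment_swap₂₃ (trdCell h)
  -- the 3-cycle
  have f0 : (finRotate 3).symm (0 : Fin 3) = 2 := by decide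
  have f1 : (finRotate 3).symm (1 : Fin 3) = 0 := by decide
  have f2 : (finRotate 3).symm (2 : Fin 3) = 1 := by decide
  have C : ∀ a b c : Fin 3, cubicMoment (trdCell h) ((finRotate 3).symm a) ((finRotate 3).symm b)
      ((finRotate 3).symm c) = cubicMoment (trdCell h) a b c := by
    intro a b c
    have e := cubicMoment_comp_inv (trdCell_invariant_cyc h) (trdCell_invariant_cyc_symm h) a b c
    simp only [cycIso_apply] at e
    exact e
  have c000 := C 0 0 0
  have c111 := C 1 1 1
  have c001 := C 0 0 1
  have c112 := C 1 1 2
  have c002 := C 0 0 2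
  have c110 := C 1 1 0
  simp only [f0, f1, f2] at c000 c111 c001 c112 c002 c110
  -- the swap
  have W : cubicMoment (trdCell h) 1 1 0 = cubicMoment (trdCell h) 0 0 1 := by
    have e := cubicMoment_comp_inv (trdCell_invariant_swap h) (trdCell_invariant_swap_symm h) 0 0 1
    simp only [swapIso_apply_zero, swapIso_apply_one] at e
    exact e
  -- the two basal-reflection relations, expanded in cubic moments
  have R2 : ∑ a : Fin 3, ∑ b : Fin 3, ∑ c : Fin 3, cubicMoment (trdCell h) a b c * (1 : ℝ) = 0 := by
    have p : ∀ x : E3, (axSumL x) ^ 3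
        = ∑ a : Fin 3, ∑ b : Fin 3, ∑ c : Fin 3, (x a * x b * x c) * (1 : ℝ) := by
      intro x; simp only [Fin.sum_univ_three, axSumL_apply, mul_one]; ring
    rw [← integral_cubic_sum hK (fun _ _ _ => (1 : ℝ))]
    simp_rw [← p]
    exact integral_axSum_cube_trdCell h
  have R1 : ∑ a : Fin 3, ∑ b : Fin 3, cubicMoment (trdCell h) a b b * (1 : ℝ) = 0 := by
    have p : ∀ x : E3, axSumL x * ‖x‖ ^ 2
        = ∑ a : Fin 3, ∑ b : Fin 3, (x a * x b * x b) * (1 : ℝ) := by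
      intro x
      rw [EuclideanSpace.real_norm_sq_eq, Fin.sum_univ_three]
      simp only [Fin.sum_univ_three, axSumL_apply, mul_one]
      ring
    rw [← integral_cubic_sum₂ hK (fun _ _ => (1 : ℝ))]
    simp_rw [← p]
    exact integral_axSum_normSq_trdCell h
  simp only [Fin.sum_univ_three, mul_one] at R1 R2
  fin_cases i <;> fin_cases j <;> fin_cases k <;> simp [cubicSign] <;>
    linarith [S12 0 1 0, S12 1 0 0, S23 0 1 0, S23 0 2 0, S12 2 0 0, S12 1 0 1, S23 1 1 0, S23 1 2 1,
      S12 2 1 1, S12 2 0 2, S23 2 2 0, S12 2 1 2, S23 2 2 1, S23 0 2 1, S12 1 0 2, S23 1 2 0,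
      S12 2 0 1, S23 2 1 0, S12 1 2 0, S12 2 1 0]

/-- `Σ_{ijk} |∫_{trdCell h} x_i x_j x_k| = 18·|∫_{trdCell h} x₀x₁x₂|`. -/
theorem sum_abs_cubicMoment_trdCell {h : ℝ} (hh : 0 ≤ h) :
    ∑ i : Fin 3, ∑ j : Fin 3, ∑ k : Fin 3, |cubicMoment (trdCell h) i j k|
      = 18 * |cubicMoment (trdCell h) 0 1 2| := by
  rw [← sum_abs_cubicSign, Finset.sum_mul]
  refine Finset.sum_congr rfl (fun i _ => ?_)
  rw [Finset.sum_mul]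
  refine Finset.sum_congr rfl (fun j _ => ?_)
  rw [Finset.sum_mul]
  refine Finset.sum_congr rfl (fun k _ => ?_)
  rw [cubicMoment_trdCell_eq hh i j k, abs_mul, mul_comm]

/-! ### Scaling -/

/-- EXACT SCALING: `trdCell h = h • trdCell 1` for `0 < h`. -/
theorem trdCell_eq_smul {h : ℝ} (hh : 0 < h) : trdCell h = h • trdCell 1 := by
  ext x
  rw [mem_smul_set_iff_inv_smul_mem₀ hh.ne', mem_trdCell, mem_trdCell, halfTwist_smul (inv_pos.2 hh),
    rdCell_eq_smul hh, mem_smul_set_iff_inv_smul_mem₀ hh.ne']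

/-- Integrals over `trdCell h` as integrals over `trdCell 1` (substitution `x = h • y`). -/
theorem setIntegral_trdCell_eq_smul {h : ℝ} (hh : 0 < h) (f : E3 → ℝ) :
    ∫ x in trdCell h, f x = h ^ 3 * ∫ x in trdCell 1, f (h • x) := by
  have e := Measure.setIntegral_comp_smul_of_pos volume f (trdCell 1) hh
  rw [finrank_euclideanSpace_fin, smul_eq_mul] at e
  rw [trdCell_eq_smul hh, e, ← mul_assoc, mul_inv_cancel₀ (pow_ne_zero 3 hh.ne'), one_mul]

/-- CUBIC MOMENT SCALING: `∫_{trdCell h} x_i x_j x_k = h⁶ · ∫_{trdCell 1} x_i x_j x_k`. -/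
theorem cubicMoment_trdCell_smul {h : ℝ} (hh : 0 < h) (i j k : Fin 3) :
    cubicMoment (trdCell h) i j k = h ^ 6 * cubicMoment (trdCell 1) i j k := by
  unfold cubicMoment
  rw [setIntegral_trdCell_eq_smul hh]
  have e : (fun x : E3 => (h • x) i * (h • x) j * (h • x) k) = fun x : E3 => h ^ 3 * (x i * x j * x k) := by
    funext x; simp only [PiLp.smul_apply, smul_eq_mul]; ring
  rw [e, integral_const_mul]; ring

/-! ### ★ The cubic clause of the ideal `h`-cell -/

/-- ★ **CUBIC CLAUSE, absolute form.**  Under the ONE cubic shape constant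
`|∫_{trdCell 1} x₀x₁x₂| ≤ 112/405`, for `0 < h` and every continuous trilinear form `B`:
`|∫_{trdCell h} B(x,x,x)| ≤ (224/45)·h⁶·‖B‖` (`= 18 · (112/405) · h⁶ · ‖B‖`). -/
theorem cubic_form_trdCell_le (hT : |∫ x in trdCell 1, x 0 * x 1 * x 2| ≤ 112 / 405) {h : ℝ}
    (hh : 0 < h) (B : E3 [×3]→L[ℝ] ℝ) :
    |∫ x in trdCell h, B (fun _ => x)| ≤ 224 / 45 * h ^ 6 * ‖B‖ := by
  have h1 := abs_integral_three_form_le (isCompact_trdCell hh.le) B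
  rw [sum_abs_cubicMoment_trdCell hh.le, cubicMoment_trdCell_smul hh, abs_mul,
    abs_of_pos (pow_pos hh 6)] at h1
  have hT' : |cubicMoment (trdCell 1) 0 1 2| ≤ 112 / 405 := hT
  calc |∫ x in trdCell h, B (fun _ => x)| ≤ 18 * (h ^ 6 * |cubicMoment (trdCell 1) 0 1 2|) * ‖B‖ := h1
    _ ≤ 18 * (h ^ 6 * (112 / 405)) * ‖B‖ := by gcongr
    _ = 224 / 45 * h ^ 6 * ‖B‖ := by ring

/-- ★ **CUBIC CLAUSE in the form consumed by `cell_taylor_tau`** (centroid `p = 0`): under the shape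
constants `hC` (volume `16h³`) and `hT`, for `0 < h`,
`∀ B, |∫_{trdCell h} B(x - 0, x - 0, x - 0)| ≤ τ·|trdCell h|·‖B‖` with `τ = (14/45)·h³`. -/
theorem cubic_clause_trdCell (hC : HasRadialMoments (rdCell 1) 16 24 (656 / 15))
    (hT : |∫ x in trdCell 1, x 0 * x 1 * x 2| ≤ 112 / 405) {h : ℝ} (hh : 0 < h) :
    ∀ B : E3 [×3]→L[ℝ] ℝ, |∫ x in trdCell h, B (fun _ => x - 0)|
      ≤ (14 / 45 * h ^ 3) * (volume (trdCell h)).toReal * ‖B‖ := by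
  intro B
  simp only [sub_zero]
  rw [volume_trdCell, volume_rdCell hC hh]
  calc |∫ x in trdCell h, B (fun _ => x)| ≤ 224 / 45 * h ^ 6 * ‖B‖ := cubic_form_trdCell_le hT hh B
    _ = 14 / 45 * h ^ 3 * (16 * h ^ 3) * ‖B‖ := by ring

/-- The cubic constant is nonnegative (as `cell_taylor_tau` requires). -/
theorem cubic_tau_nonneg {h : ℝ} (hh : 0 ≤ h) : 0 ≤ 14 / 45 * h ^ 3 := by positivity

/-- ★ The cubic clause at nearest-neighbour distance `ν` (`h = ν/(2√2)`): `τ = (14/45)(ν/(2√2))³`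
(`= 7ν³/(360√2) ≈ 0.01375·ν³`). -/
theorem cubic_clause_trdCell_nu (hC : HasRadialMoments (rdCell 1) 16 24 (656 / 15))
    (hT : |∫ x in trdCell 1, x 0 * x 1 * x 2| ≤ 112 / 405) {ν : ℝ} (hν : 0 < ν) :
    ∀ B : E3 [×3]→L[ℝ] ℝ, |∫ x in trdCell (ν / (2 * Real.sqrt 2)), B (fun _ => x - 0)|
      ≤ (14 / 45 * (ν / (2 * Real.sqrt 2)) ^ 3) * (volume (trdCell (ν / (2 * Real.sqrt 2)))).toReal * ‖B‖ :=
  cubic_clause_trdCell hC hT (div_pos hν (by positivity))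

/-- The cubic constant in nearest-neighbour units: `(14/45)(ν/(2√2))³ = 7ν³/(360√2)`. -/
theorem cubic_tau_nu (ν : ℝ) : 14 / 45 * (ν / (2 * Real.sqrt 2)) ^ 3 = 7 * ν ^ 3 / (360 * Real.sqrt 2) := by
  have hs : (0 : ℝ) < Real.sqrt 2 := by positivity
  have hs' : Real.sqrt 2 ≠ 0 := hs.ne'
  have h2 : Real.sqrt 2 ^ 2 = 2 := Real.sq_sqrt (by norm_num)
  have h3 : Real.sqrt 2 ^ 3 = 2 * Real.sqrt 2 := by
    rw [show (3 : ℕ) = 2 + 1 from rfl, pow_succ, h2]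
  rw [div_pow, mul_pow, h3]
  field_simp
  ring


end

end Summit.AtomisticToContinuum.Crystallization.Theorems.OverbindingBudgetAffineFarFieldCellTRDCubic
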